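import Mathlib.NumberTheory.Padics.RingHoms
import Mathlib.NumberTheory.Padics.ProperSpace
import Mathlib.Topology.Algebra.Module.Basic
import Mathlib.LinearAlgebra.Dimension.Constructions
import Mathlib.LinearAlgebra.Dimension.Finrank
import Mathlib.LinearAlgebra.FreeModule.PID
import Mathlib.Data.Nat.Factorization.Basic
import Literature.NumberTheory.GaloisRepresentations.LocalGlobalCohomologyFiniteProofs
import HarnessLib

/-!
# Homomorphisms `K^× → ℤ_l` and `K^× → ℤ_p^{d+1}` with dense image (rank witnesses)

Proof-only file (no definitions, no named facts), companion of `MLFUnitGroupRankBoundProofs.lean`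
(the upper bounds; this file is logically independent of it).
For a non-archimedean local field `K` (Mathlib `IsNonarchimedeanLocalField`, valued model) we
PROVE the EXISTENCE half of the rank formula of S. Mochizuki, *Topics in Absolute Anabelian
Geometry I* (2012) [AbsTopI] Thm 2.6 (ii) p. 21 ("`δ¹_l(G) = 1` if `l ≠ p`, `δ¹_p(G) = [k : ℚ_p] + 1`")
on the `K^×` side (`G_K^{ab} ≅ (K^×)^∧`, [AbsAnab] §1.2 p. 9):

* `exists_mulEquiv_units_int_prod_integerUnits` — `K^× ≅ ℤ × 𝒪_K^×` (a uniformiser `ϖ`;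
  Neukirch, *Algebraic Number Theory* II (5.7): "`K^* = (π) × 𝒪^*`"; tree `exists_eq_units_mul_zpow`
  gives surjectivity, the valuation gives injectivity);
* `exists_denseRange_units_padicInt_one` — for every prime `l` there is a homomorphism
  `K^× → ℤ_l` with dense image (the normalised valuation followed by `ℤ ⊆ ℤ_l`);
* `exists_denseRange_units_padicInt_succ` — if `𝒪_K^×` has a subgroup `W` of finite index with
  `W ≃ ℤ_p^d` (abstractly; e.g. `U₂ = 1 + p²𝒪_K`, `d = [K:ℚ_p]`), there is a homomorphism
  `K^× → ℤ_p^{d+1}` with dense image: `x = ϖ^j u ↦ (j, θ(u^m))` where `m = [𝒪_K^× : W]`,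
  `u ↦ u^m ∈ W ≃ ℤ_p^d` has image a subgroup `H ⊇ m ℤ_p^d`, which is automatically a
  `ℤ_p`-submodule of full rank (`smul_mem_of_nat_smul_mem`), hence `θ : H ≅ ℤ_p^d`.

HONEST FRAMING: classical and undisputed; nothing here bears on [IUTchIII] Cor. 3.12.
-/

noncomputable section

open ValuativeRel Topology Filter

namespace Literature.AnabelianGeometry.AbsoluteAnabelian

open Literature.NumberTheory.GaloisRepresentations

/-! ### Subgroups of `ℤ_pⁿ` containing `m ℤ_pⁿ` are submodules of full rank -/

section Sandwich

variable {p : ℕ} [Fact p.Prime]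

/-- Local copy of `MLFUnitGroupRankBoundProofs.le_finrank_of_smul_le_aux` (kept private so that this
file elaborates independently of its sibling): if `m ≠ 0` and `m · ℤ_lⁿ ⊆ L` for a submodule
`L ≤ ℤ_lⁿ`, then `n ≤ rank L`. [folklore] -/
private theorem le_finrank_of_smul_le_aux {l : ℕ} [Fact l.Prime] {n : ℕ} {m : ℕ} (hm : m ≠ 0)
    (L : Submodule ℤ_[l] (Fin n → ℤ_[l])) (hL : ∀ a : Fin n → ℤ_[l], (m : ℤ_[l]) • a ∈ L) :
    n ≤ Module.finrank ℤ_[l] L := by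
  let μ : (Fin n → ℤ_[l]) →ₗ[ℤ_[l]] (Fin n → ℤ_[l]) := (m : ℤ_[l]) • LinearMap.id
  have hμ : Function.Injective μ := by
    have hm' : (m : ℤ_[l]) ≠ 0 := by exact_mod_cast hm
    intro x y hxy
    exact smul_right_injective (Fin n → ℤ_[l]) hm' hxy
  have hrange : LinearMap.range μ ≤ L := by
    rintro _ ⟨a, rfl⟩
    exact hL a
  haveI : Module.Finite ℤ_[l] L := Module.Finite.iff_fg.mpr (IsNoetherian.noetherian L)
  have h1 : Module.finrank ℤ_[l] (LinearMap.range μ) = n := by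
    rw [LinearMap.finrank_range_of_inj hμ, Module.finrank_fin_fun]
  have h2 := LinearMap.finrank_le_finrank_of_injective (Submodule.inclusion_injective hrange)
  rwa [h1] at h2



/-- A subgroup `H ≤ ℤ_pⁿ` containing `m · ℤ_pⁿ` (`m ≠ 0`) is stable under `ℤ_p`: write
`m = p^s m'` with `p ∤ m'` and `c = c₀ + p^s b` with `c₀ ∈ ℕ` (`PadicInt.appr`); then
`c x = c₀ x + m (m'⁻¹ b x)`. [folklore] -/
private theorem smul_mem_of_nat_smul_mem {n m : ℕ} (hm : m ≠ 0) (H : AddSubgroup (Fin n → ℤ_[p]))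
    (hH : ∀ a : Fin n → ℤ_[p], (m : ℤ_[p]) • a ∈ H) (c : ℤ_[p]) {x : Fin n → ℤ_[p]}
    (hx : x ∈ H) : c • x ∈ H := by
  have hp : p.Prime := Fact.out
  obtain ⟨s, m', hm', hms⟩ := Nat.exists_eq_pow_mul_and_not_dvd hm p hp.one_lt.ne'
  -- `m'` is a unit of `ℤ_p`
  have hu : IsUnit (m' : ℤ_[p]) := by
    rw [PadicInt.isUnit_iff]
    have h1 : ‖((m' : ℤ) : ℤ_[p])‖ = 1 := by
      apply le_antisymm (PadicInt.norm_le_one _)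
      by_contra hlt
      have hlt' : ‖((m' : ℤ) : ℤ_[p])‖ < 1 := lt_of_not_ge hlt
      rw [PadicInt.norm_int_lt_one_iff_dvd] at hlt'
      exact hm' (by exact_mod_cast hlt')
    simpa using h1
  obtain ⟨u, hu'⟩ := hu
  -- `c = c₀ + p^s b`
  obtain ⟨c₀, b, hc⟩ : ∃ (c₀ : ℕ) (b : ℤ_[p]), c = (c₀ : ℤ_[p]) + ((p ^ s : ℕ) : ℤ_[p]) * b := by
    have hmem := PadicInt.appr_spec s c
    rw [Ideal.mem_span_singleton'] at hmem
    obtain ⟨b, hb⟩ := hmem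
    refine ⟨PadicInt.appr c s, b, ?_⟩
    rw [Nat.cast_pow, mul_comm, hb]
    ring
  have hkey : c • x = c₀ • x + (m : ℤ_[p]) • ((((u⁻¹ : ℤ_[p]ˣ) : ℤ_[p]) * b) • x) := by
    rw [hc, add_smul, Nat.cast_smul_eq_nsmul, smul_smul, hms, Nat.cast_mul, ← hu']
    congr 1
    congr 1
    rw [mul_assoc, ← mul_assoc (u : ℤ_[p]), Units.mul_inv, one_mul]
  rw [hkey]
  exact H.add_mem (H.nsmul_mem hx c₀) (hH _)

/-- A subgroup `H ≤ ℤ_p^d` containing `m · ℤ_p^d` (`m ≠ 0`) is (additively) isomorphic to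
`ℤ_p^d`: it is a `ℤ_p`-submodule, finitely generated and torsion-free, hence free, of rank `d`.
(The lattice bookkeeping of [AbsAnab] Lemma 1.1.4 (ii) proof p. 8.)
[cite: MochizukiAbsAnab2004, Lemma 1.1.4 (ii) proof p.8] -/
theorem nonempty_addEquiv_of_nat_smul_mem {d m : ℕ} (hm : m ≠ 0)
    (H : AddSubgroup (Fin d → ℤ_[p])) (hH : ∀ a : Fin d → ℤ_[p], (m : ℤ_[p]) • a ∈ H) :
    Nonempty (H ≃+ (Fin d → ℤ_[p])) := by
  classical
  let H' : Submodule ℤ_[p] (Fin d → ℤ_[p]) :=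
    { carrier := H
      add_mem' := fun ha hb => H.add_mem ha hb
      zero_mem' := H.zero_mem
      smul_mem' := fun c x hx => smul_mem_of_nat_smul_mem hm H hH c hx }
  have hmemH' : ∀ x, x ∈ H' ↔ x ∈ H := fun x => Iff.rfl
  haveI : Module.Finite ℤ_[p] H' := Module.Finite.iff_fg.mpr (IsNoetherian.noetherian H')
  haveI : Module.Free ℤ_[p] H' := Module.free_of_finite_type_torsion_free'
  have h1 : d ≤ Module.finrank ℤ_[p] H' := le_finrank_of_smul_le_aux hm H' (fun a => hH a)
  have h2 : Module.finrank ℤ_[p] H' ≤ d := by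
    have := Submodule.finrank_le H'
    rwa [Module.finrank_fin_fun] at this
  have hd : Module.finrank ℤ_[p] H' = d := le_antisymm h2 h1
  let bH : Module.Basis (Fin d) ℤ_[p] H' := Module.finBasisOfFinrankEq ℤ_[p] H' hd
  let e : H' ≃ₗ[ℤ_[p]] (Fin d → ℤ_[p]) := bH.equivFun
  let ι : H ≃+ H' :=
    { toFun := fun x => ⟨x.1, (hmemH' x.1).mpr x.2⟩
      invFun := fun x => ⟨x.1, (hmemH' x.1).mp x.2⟩
      left_inv := fun x => rfl
      right_inv := fun x => rfl
      map_add' := fun x y => rfl }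
  exact ⟨ι.trans e.toAddEquiv⟩

end Sandwich

/-! ### `K^× ≅ ℤ × 𝒪_K^×` and the witnesses -/

section Witness

variable (K : Type*) [Field K] [ValuativeRel K] [TopologicalSpace K] [IsNonarchimedeanLocalField K]

/-- **`K^× ≅ ℤ × 𝒪_K^×`** for a non-archimedean local field: for a uniformiser `ϖ`, the
homomorphism `(j, u) ↦ ϖ^j u` is bijective (surjective by the tree's `exists_eq_units_mul_zpow`,
injective because `v(ϖ)^j = 1` forces `j = 0`).  Neukirch, *Algebraic Number Theory* II (5.7)
"`K^* = (π) × 𝒪^*`"; the decomposition behind [AbsAnab] §1.2's `G_K^{ab} ↠ Ẑ` with kernel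
`Im(𝒪_K^×)` (pp. 9–10). [cite: MochizukiAbsAnab2004, §1.2 p.9] -/
theorem exists_mulEquiv_units_int_prod_integerUnits :
    ∃ e : Kˣ ≃* Multiplicative ℤ × (𝒪[K])ˣ,
      ∀ u : (𝒪[K])ˣ, e (Units.map (𝒪[K].subtype : 𝒪[K] →* K) u) = (1, u) := by
  classical
  letI : UniformSpace K := IsTopologicalAddGroup.rightUniformSpace K
  haveI : IsUniformAddGroup K := isUniformAddGroup_of_addCommGroup
  set ι : (𝒪[K])ˣ →* Kˣ := Units.map (𝒪[K].subtype : 𝒪[K] →* K) with hι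
  obtain ⟨π, hπ⟩ := IsDiscreteValuationRing.exists_irreducible 𝒪[K]
  have hπ0 : (π : K) ≠ 0 := fun h => hπ.ne_zero (Subtype.ext h)
  let πu : Kˣ := Units.mk0 (π : K) hπ0
  let Φ : Multiplicative ℤ × (𝒪[K])ˣ →* Kˣ := MonoidHom.coprod (zpowersHom Kˣ πu) ι
  have hΦ_apply : ∀ (j : ℤ) (u : (𝒪[K])ˣ), Φ (Multiplicative.ofAdd j, u) = πu ^ j * ι u := by
    intro j u
    simp [Φ, MonoidHom.coprod_apply]
  have hι_inj : Function.Injective ι := Units.map_injective Subtype.val_injective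
  -- valuations
  have hvπ : valuation K (π : K) < 1 :=
    Valuation.Integers.valuation_irreducible_lt_one (Valuation.integer.integers (valuation K)) hπ
  have hvι : ∀ u : (𝒪[K])ˣ, valuation K ((ι u : Kˣ) : K) = 1 := fun u =>
    Valuation.Integers.valuation_unit (Valuation.integer.integers (valuation K)) u
  have hsurj : Function.Surjective Φ := by
    intro x
    obtain ⟨j, u, hx⟩ := exists_eq_units_mul_zpow K hπ x
    refine ⟨(Multiplicative.ofAdd j, u), ?_⟩
    rw [hΦ_apply, mul_comm]
    ext
    rw [Units.val_mul, Units.val_zpow_eq_zpow_val]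
    exact hx.symm
  have hinj : Function.Injective Φ := by
    rw [injective_iff_map_eq_one]
    rintro ⟨j, u⟩ h
    have h' : πu ^ (Multiplicative.toAdd j) * ι u = 1 := by
      rw [← hΦ_apply]; simpa using h
    -- take valuations: `v(π)^j = 1`, so `j = 0`
    have h1 : valuation K (π : K) ^ (Multiplicative.toAdd j) = 1 := by
      have h0 : valuation K (((πu ^ (Multiplicative.toAdd j) * ι u : Kˣ) : K)) = 1 := by
        rw [h', Units.val_one, map_one]
      rwa [Units.val_mul, map_mul, hvι, mul_one, Units.val_zpow_eq_zpow_val, map_zpow₀] at h0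
    have hpos : 0 < valuation K (π : K) := (Valuation.pos_iff _).mpr hπ0
    have hj : Multiplicative.toAdd j = 0 := by
      have hanti := zpow_right_strictAnti₀ hpos hvπ
      refine hanti.injective ?_
      rw [h1, zpow_zero]
    have hj' : j = 1 := by
      have := congrArg Multiplicative.ofAdd hj
      simpa using this
    have hu : ι u = 1 := by
      rw [hj, zpow_zero, one_mul] at h'
      exact h'
    have hu' : u = 1 := hι_inj (by rw [hu, map_one])
    rw [hj', hu']
    rfl
  let e : Kˣ ≃* Multiplicative ℤ × (𝒪[K])ˣ := (MulEquiv.ofBijective Φ ⟨hinj, hsurj⟩).symm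
  refine ⟨e, fun u => ?_⟩
  apply (MulEquiv.ofBijective Φ ⟨hinj, hsurj⟩).injective
  rw [MulEquiv.apply_symm_apply]
  change ι u = Φ (Multiplicative.ofAdd 0, u)
  rw [hΦ_apply, zpow_zero, one_mul]

/-- **A homomorphism `K^× → ℤ_l` with dense image exists for every prime `l`**: the normalised
valuation `K^× ↠ ℤ` followed by the dense inclusion `ℤ ⊆ ℤ_l`.  This is the witness for
"`δ¹_l(G_k) ≥ 1`" in [AbsTopI] Thm 2.6 (ii) (the unramified `ℤ_l`-quotient of `G_k^{ab}`).
[cite: MochizukiAbsTopI2012, Thm 2.6 (ii) p.21] -/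
theorem exists_denseRange_units_padicInt_one (l : ℕ) [Fact l.Prime] :
    ∃ f : Kˣ →* Multiplicative (Fin 1 → ℤ_[l]), DenseRange f := by
  classical
  obtain ⟨e, -⟩ := exists_mulEquiv_units_int_prod_integerUnits K
  -- `ℤ → ℤ_l¹`, `j ↦ (j)`
  let φ : ℤ →+ (Fin 1 → ℤ_[l]) :=
    { toFun := fun j _ => (j : ℤ_[l])
      map_zero' := by funext i; simp
      map_add' := fun a b => by funext i; simp }
  let f : Kˣ →* Multiplicative (Fin 1 → ℤ_[l]) :=
    (AddMonoidHom.toMultiplicative φ).comp ((MonoidHom.fst _ _).comp e.toMonoidHom)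
  refine ⟨f, ?_⟩
  -- dense range: `e`, `fst` surjective; `ℤ` dense in `ℤ_l`; `ℤ_l ≅ ℤ_l¹`
  have hconst : DenseRange (fun a : ℤ_[l] => fun _ : Fin 1 => a) := by
    refine Function.Surjective.denseRange fun v => ⟨v 0, ?_⟩
    funext i
    rw [Subsingleton.elim i 0]
  have hφ : DenseRange (fun j : ℤ => fun _ : Fin 1 => (j : ℤ_[l])) :=
    hconst.comp PadicInt.denseRange_intCast (continuous_pi fun _ => continuous_id)
  have hsurj : Function.Surjective (fun x : Kˣ => Multiplicative.toAdd (e x).1) := by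
    intro j
    obtain ⟨x, hx⟩ := e.surjective (Multiplicative.ofAdd j, 1)
    exact ⟨x, by simp [hx]⟩
  have hF : DenseRange (fun x : Kˣ => fun _ : Fin 1 => ((Multiplicative.toAdd (e x).1 : ℤ) : ℤ_[l])) :=
    hφ.comp hsurj.denseRange (continuous_of_discreteTopology)
  have hf_eq : (fun x : Kˣ => (f x : Multiplicative (Fin 1 → ℤ_[l]))) =
      fun x => Multiplicative.ofAdd (fun _ : Fin 1 => ((Multiplicative.toAdd (e x).1 : ℤ) : ℤ_[l])) := by
    funext x
    rfl
  change DenseRange (fun x : Kˣ => (f x : Multiplicative (Fin 1 → ℤ_[l])))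
  rw [hf_eq]
  exact Multiplicative.ofAdd.surjective.denseRange.comp hF continuous_ofAdd

/-- **A homomorphism `K^× → ℤ_p^{d+1}` with dense image** exists as soon as `𝒪_K^×` has a
subgroup `W` of finite index `m` with `W ≃ ℤ_p^d` (abstractly): `ϖ^j u ↦ (j, θ(u^m))`, where
`u ↦ u^m ∈ W ≃ ℤ_p^d` has image `H ⊇ m ℤ_p^d`, `θ : H ≅ ℤ_p^d`
(`nonempty_addEquiv_of_nat_smul_mem`); the image `ℤ × ℤ_p^d` is dense in `ℤ_p^{d+1}`.  This is
the witness for "`δ¹_p(G_k) ≥ [k : ℚ_p] + 1`" in [AbsTopI] Thm 2.6 (ii) (`K^× ≅ ℤ × 𝒪_K^×`,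
`𝒪_K^× ⊇ ℤ_p^{[k:ℚ_p]}` of finite index). [cite: MochizukiAbsTopI2012, Thm 2.6 (ii) p.21] -/
theorem exists_denseRange_units_padicInt_succ {p : ℕ} [Fact p.Prime] {d : ℕ}
    (W : Subgroup (𝒪[K])ˣ) [W.FiniteIndex] (eW : W ≃* Multiplicative (Fin d → ℤ_[p])) :
    ∃ f : Kˣ →* Multiplicative (Fin (d + 1) → ℤ_[p]), DenseRange f := by
  classical
  obtain ⟨e, he⟩ := exists_mulEquiv_units_int_prod_integerUnits K
  set m : ℕ := W.index with hm_def
  have hm0 : m ≠ 0 := Subgroup.FiniteIndex.index_ne_zero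
  -- `g : 𝒪ˣ → ℤ_p^d`, `u ↦ eW (u^m)` (additively)
  let gW : (𝒪[K])ˣ →* W := (powMonoidHom m).codRestrict W (fun u => Subgroup.pow_index_mem W u)
  let g : (𝒪[K])ˣ →* Multiplicative (Fin d → ℤ_[p]) := eW.toMonoidHom.comp gW
  have hg_apply : ∀ u, g u = eW ⟨u ^ m, Subgroup.pow_index_mem W u⟩ := fun u => rfl
  -- its image `H ⊇ m ℤ_p^d`
  let H : AddSubgroup (Fin d → ℤ_[p]) := AddSubgroup.toSubgroup.symm g.range
  have hH_mem : ∀ a, a ∈ H ↔ Multiplicative.ofAdd a ∈ g.range := fun a => Iff.rfl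
  have hH : ∀ a : Fin d → ℤ_[p], (m : ℤ_[p]) • a ∈ H := by
    intro a
    rw [hH_mem]
    obtain ⟨w, hw⟩ := eW.surjective (Multiplicative.ofAdd a)
    refine ⟨W.subtype w, ?_⟩
    rw [hg_apply]
    have hwm : (⟨(W.subtype w) ^ m, Subgroup.pow_index_mem W _⟩ : W) = w ^ m := by
      ext; simp
    rw [hwm, map_pow, hw, Nat.cast_smul_eq_nsmul, ofAdd_nsmul]
  obtain ⟨θ⟩ := nonempty_addEquiv_of_nat_smul_mem hm0 H hH
  -- the additive map `F : K^× → ℤ_p^{d+1}`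
  let gH : (𝒪[K])ˣ → H := fun u => ⟨Multiplicative.toAdd (g u), (hH_mem _).mpr ⟨u, rfl⟩⟩
  have hgH_mul : ∀ u v, gH (u * v) = gH u + gH v := fun u v => by
    ext1; simp [gH, map_mul, toAdd_mul]
  let F : Kˣ → (Fin (d + 1) → ℤ_[p]) := fun x =>
    Fin.cons (((Multiplicative.toAdd (e x).1 : ℤ) : ℤ_[p])) (θ (gH (e x).2))
  have hF_mul : ∀ x y, F (x * y) = F x + F y := by
    intro x y
    simp only [F, map_mul, Prod.fst_mul, Prod.snd_mul, toAdd_mul, Int.cast_add, hgH_mul, map_add]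
    funext i
    refine Fin.cases ?_ (fun j => ?_) i
    · simp
    · simp
  let f : Kˣ →* Multiplicative (Fin (d + 1) → ℤ_[p]) :=
    { toFun := fun x => Multiplicative.ofAdd (F x)
      map_one' := by
        have h1 : F 1 = 0 := by
          have := hF_mul 1 1
          rw [mul_one] at this
          simpa using this
        rw [h1]; rfl
      map_mul' := fun x y => by rw [hF_mul, ofAdd_add] }
  refine ⟨f, ?_⟩
  -- dense range: `F` hits `ℤ × ℤ_p^d`, dense in `ℤ_p^{d+1}`
  have hE : DenseRange (fun q : ℤ × (Fin d → ℤ_[p]) =>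
      (Fin.cons ((q.1 : ℤ_[p])) q.2 : Fin (d + 1) → ℤ_[p])) := by
    have hcons : Function.Surjective (fun q : ℤ_[p] × (Fin d → ℤ_[p]) =>
        (Fin.cons q.1 q.2 : Fin (d + 1) → ℤ_[p])) := fun v =>
      ⟨(v 0, Fin.tail v), by simp⟩
    have hcont : Continuous (fun q : ℤ_[p] × (Fin d → ℤ_[p]) =>
        (Fin.cons q.1 q.2 : Fin (d + 1) → ℤ_[p])) := by
      refine continuous_pi fun i => ?_
      refine Fin.cases ?_ (fun j => ?_) i
      · simp only [Fin.cons_zero]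
        exact continuous_fst
      · simp only [Fin.cons_succ]
        exact (continuous_apply j).comp continuous_snd
    have hprod : DenseRange (Prod.map (Int.cast : ℤ → ℤ_[p]) (id : (Fin d → ℤ_[p]) → _)) :=
      PadicInt.denseRange_intCast.prodMap Function.surjective_id.denseRange
    have heq : (fun q : ℤ × (Fin d → ℤ_[p]) =>
        (Fin.cons ((q.1 : ℤ_[p])) q.2 : Fin (d + 1) → ℤ_[p])) =
        (fun q : ℤ_[p] × (Fin d → ℤ_[p]) => (Fin.cons q.1 q.2 : Fin (d + 1) → ℤ_[p])) ∘
          Prod.map (Int.cast : ℤ → ℤ_[p]) (id : (Fin d → ℤ_[p]) → _) := by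
      funext q
      rcases q with ⟨a, b⟩
      rfl
    rw [heq]
    exact hcons.denseRange.comp hprod hcont
  have hS : Function.Surjective (fun x : Kˣ => ((Multiplicative.toAdd (e x).1 : ℤ), θ (gH (e x).2))) := by
    rintro ⟨j, w⟩
    -- `θ` is onto, and `gH` is onto `H` by construction
    obtain ⟨h, hh⟩ := θ.surjective w
    obtain ⟨u, hu⟩ : ∃ u, gH u = h := by
      obtain ⟨u, hu⟩ := (hH_mem _).mp h.2
      exact ⟨u, Subtype.ext (by simp [gH, hu])⟩
    obtain ⟨x, hx⟩ := e.surjective (Multiplicative.ofAdd j, u)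
    refine ⟨x, ?_⟩
    simp [hx, hu, hh]
  have hF : DenseRange F := by
    have hc : Continuous (fun q : ℤ × (Fin d → ℤ_[p]) =>
        (Fin.cons ((q.1 : ℤ_[p])) q.2 : Fin (d + 1) → ℤ_[p])) := by
      refine continuous_pi fun i => ?_
      refine Fin.cases ?_ (fun j => ?_) i
      · simp only [Fin.cons_zero]
        exact (continuous_of_discreteTopology (f := (Int.cast : ℤ → ℤ_[p]))).comp continuous_fst
      · simp only [Fin.cons_succ]
        exact (continuous_apply j).comp continuous_snd
    have hF_eq : F = (fun q : ℤ × (Fin d → ℤ_[p]) =>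
        (Fin.cons ((q.1 : ℤ_[p])) q.2 : Fin (d + 1) → ℤ_[p])) ∘
        (fun x : Kˣ => ((Multiplicative.toAdd (e x).1 : ℤ), θ (gH (e x).2))) := by
      funext x
      rfl
    rw [hF_eq]
    exact hE.comp hS.denseRange hc
  change DenseRange (fun x : Kˣ => Multiplicative.ofAdd (F x))
  exact Multiplicative.ofAdd.surjective.denseRange.comp hF continuous_ofAdd

end Witness

end Literature.AnabelianGeometry.AbsoluteAnabelian
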